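import Summits.QuantumFields.YangMills.Theorems.BalabanUVNodesN12ForestSliceLeftField
import Summits.QuantumFields.YangMills.Theorems.BalabanUVNodesN12ForestSlice
import Literature.MathematicalPhysics.QuantumFieldTheory.Balaban1983to89.B15Prop1LinearisedKernelDictionary
import HarnessLib

/-!
# BalabanUVNodes ∕ N12 — dag-n12-w1's LETTER `hR` ∕ [15] (45) VERBATIM FOR THE FOREST SLICE (`SU(2)`): for every real datum `τ` a REAL bond field `p` with `cplxVec p` IN THE COMPLEX FOREST
# SLICE and `Q_{j_i}(↑U₀)[b ↦ (Σ_a p_{b,a}E_a)·U₀,b](c_i) = ↑W_{j_i}(c_i)·Σ_a τ_{i,a}E_a` — the companion's left field `p̂` in `SU(2)` coordinates (`𝔰𝔲(2) = Σ_a ℝ·E_a`, dag-n12-w1's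
# `exists_coord_of_mem_lieSU_two`); at a guarded curved base from surjectivity there, and at the record's `𝐁_k(Z)` HYPOTHESIS-FREE at the flat base (and on one radius of guarded near-flat bases)

Cell `pub-ymgap` (HUMAN RULINGS D-0062 ∕ D-0149), WIDTH SEAT `pub-ymgap-dag-n12-w3` g3 (node N12 = [B15]; key K1⁸ `stmt-QuantumFields-26907`, `--kind proof --supports … --as helper`;
count-neutral).  THEOREMS ONLY (0 `def`, 0 `instance`, 0 `sorry`); consumed BY NAME: this seat's `N12ForestSliceLeftField.exists_forest_leftField_of_surjective_curved` ∕ `N12ForestSlice.exists_forestSlice` ∕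
`N12RootedForest.exists_rootedForest_Bj` ∕ `forest_F1`, dag-n12-w1's `B15Prop1LinearisedKernelDictionary.exists_coord_of_mem_lieSU_two` ∕ `B15Prop1OntoFromRightInverse.logCoordCLM_genE_sum` ∕
`B15Prop1LinearisedDatumCoordinates.exists_logCoordCLM` ∕ `B15SU2ChartHolomorphic.star_genE` ∕ `genE_trace` ∕ `B15Prop1AnalyticExtClause.cplxVec`, dag-n10-w1's
`N12GuardedLinAvgRightInverseBj.surjective_fderiv_msChart_Bj(_one)`, `N12GuardedChartDerivIterLin.exists_stokesThreshold` ∕ `plaqSmall_iter_one`.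

WHY.  The displayed letter of `B15Prop1LinearisedKernelDictionary.hMin_atRecord_of_node00Letters` (per base field `U₀`, slice `S`):
«`∀ τ, ∃ p : VecField P 0 E3, cplxVec p ∈ S ∧ ∀ i, dIterL j_i (coeField U₀) (b ↦ (Σ_a ((p b a : ℝ) : ℂ) • genE a) * ↑U₀,b) c_i = ↑W_{j_i}(c_i) * Σ_b ((τ i b : ℝ) : ℂ) • genE b`».  The companion
`N12ForestSliceLeftField` produces the `𝔰𝔲(N)`-valued left field `p̂` vanishing on the forest; for `N = 2` every `p̂_b ∈ 𝔰𝔲(2)` has unique real coordinates in the basis `E_a` (unique because the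
logarithmic-coordinate map `T` inverts `y ↦ Σ y_a E_a`), the coordinates of `0` are `0`, so the real field `p` vanishes on the forest and `cplxVec p` lies in the complex forest slice of
`N12ForestSlice.exists_forestSlice` — the SAME `S` that carries (σ1)–(σ4) (`B15Prop1AxialGaugeSectionOfForest`) and (β)♭ (`N12ForestSlice`).  After this file the per-base-field letters of the
forest slice displayed in the lane are: surjectivity of `DΦ_{U₀}(0)` at the base (discharged at the flat base and on n10-w1's near-flat radius at the record) and the (β) letter at a curved base.

CONTENTS.  §1 `sum_ofReal_smul_genE_mem_lieSU` (`Σ_a y_a E_a ∈ 𝔰𝔲(2)` for real `y`), `exists_realCoord_lieSU_two_field` (a real coordinate field `p` of an `𝔰𝔲(2)`-field `p̂` with `p̂_b = 0 ⇒ p_b = 0`).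
§2 ★★★ `exists_forest_hR_of_surjective_curved` (guarded `U₀`, surjectivity DISPLAYED, `S` = the forest slice by (F3): the letter verbatim), ★★ `…_of_agreeOn` (datum `W` on the right).
§3 ★★★ `exists_forest_hR_Bj_one_atRecord` (`∃ path S`, (F1) ∧ (F2) ∧ (TREE) ∧ (F3) ∧ conj-stable ∧ the letter at `U₀ = 1` — hypothesis-free beyond `2 ≤ M₁`, `1 ≤ k ≤ m + K`, cover divisibility),
★★★ `exists_forest_hR_Bj_nearFlat_atRecord` (one forest∕slice, one `ρ′`, every guarded `U₀` with `‖↑U₀ − 1‖ < ρ′`).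

HONEST FRAMING.  `SU(2)`-coordinate bookkeeping by name; surjectivity at a general guarded `U₀` displayed in §2; the (β) letter at a curved base, (E) and `hT1u` stay displayed in the lane;
nothing of Bałaban's estimates asserted; N12 NOT discharged; K1⁸ NOT closed; counts unmoved (typed 28∕28 · discharged 5∕27); one finite 𝕋⁴ programme at fixed ε — R4 closes the conditional
rung `BalabanLadder.UV` only; the Yang–Mills mass gap (Clay) is NOT proved by any of this; nothing continuum ∕ ℝ⁴ ∕ OS.
-/

noncomputable section

namespace Summit.QuantumFields.YangMills.BalabanUVNodes.N12ForestSliceHR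

open scoped BigOperators Matrix.Norms.L2Operator Topology ComplexConjugate
open Literature.MathematicalPhysics.QuantumFieldTheory.Balaban1983to89
open T4Continuum
open B15DeterminingSets
open BlockAveraging (blockAvg)
open ExpMeanLog (expMeanLogSU deltaSU)
open T4AdjointCovarianceUnitary (lieSU mem_lieSU_iff)
open Node00
open B15SU2ChartHolomorphic (genE star_genE genE_trace)
open B15Prop1AnalyticExtClause (cplxVec)
open B15Prop1ChartCalculusSU2 (E3)
open B15ComplexifiedDatumFamily (conjVec)
open B15Prop1LinearisedDatumCoordinates (exists_logCoordCLM)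
open B15Prop1OntoFromRightInverse (logCoordCLM_genE_sum)
open B15Prop1LinearisedKernelDictionary (exists_coord_of_mem_lieSU_two)
open Summit.QuantumFields.YangMills.Theorems.BlockAvgCorrector (stokesConst)
open Summit.QuantumFields.YangMills.BalabanUVNodes.N12GuardedChartDerivIterLin (exists_stokesThreshold plaqSmall_iter_one)
open Summit.QuantumFields.YangMills.BalabanUVNodes.N12GuardedLinAvgRightInverseBj (surjective_fderiv_msChart_Bj_one surjective_fderiv_msChart_Bj)
open Summit.QuantumFields.YangMills.BalabanUVNodes.N12RootedForest (forest_F1 exists_rootedForest_Bj)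
open Summit.QuantumFields.YangMills.BalabanUVNodes.N12ForestSlice (exists_forestSlice)
open Summit.QuantumFields.YangMills.BalabanUVNodes.N12ForestSliceLeftField (exists_forest_leftField_of_surjective_curved)

variable {P : Params}

/-! ## §1 Real coordinates in `𝔰𝔲(2)` -/

/-- A real combination of the generators `E_a` lies in `𝔰𝔲(2)` (`E_a⋆ = −E_a`, `tr E_a = 0`). [cite: Balaban1989LargeFieldII, (1.19) p.360; Balaban1985Averaging, (17) p.21] -/
theorem sum_ofReal_smul_genE_mem_lieSU (y : Fin 3 → ℝ) : (∑ a : Fin 3, ((y a : ℝ) : ℂ) • genE a) ∈ lieSU (Fin 2) := by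
  rw [mem_lieSU_iff]
  refine ⟨?_, ?_⟩
  · rw [star_sum, ← Finset.sum_neg_distrib]
    refine Finset.sum_congr rfl fun a _ => ?_
    rw [star_smul, star_genE, Complex.star_def, Complex.conj_ofReal, smul_neg]
  · rw [Matrix.trace_sum]
    exact Finset.sum_eq_zero fun a _ => by rw [Matrix.trace_smul, genE_trace, smul_zero]

/-- **REAL COORDINATES OF AN `𝔰𝔲(2)`-FIELD**: every `p̂ : bonds → 𝔰𝔲(2)` is `b ↦ Σ_a p_{b,a}E_a` for a real bond field `p`, with `p_b = 0` wherever `p̂_b = 0` (the coordinates are unique: the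
logarithmic-coordinate map inverts `y ↦ Σ y_a E_a`). [cite: Balaban1989LargeFieldII, (1.19) p.360; Balaban1985Averaging, (17),(21) p.21] -/
theorem exists_realCoord_lieSU_two_field {j : ℕ} (q : PBond P j → lieSU (Fin 2)) :
    ∃ p : VecField P j E3, (∀ b, (∑ a : Fin 3, ((p b a : ℝ) : ℂ) • genE a) = (q b : Matrix (Fin 2) (Fin 2) ℂ)) ∧ ∀ b, q b = 0 → p b = 0 := by
  choose y hy using fun b => exists_coord_of_mem_lieSU_two (q b).2
  obtain ⟨T, hT⟩ := exists_logCoordCLM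
  refine ⟨y, fun b => (hy b).symm, fun b hb => ?_⟩
  -- coordinates of `0` are `0`: apply `T`
  have h0 : (∑ a : Fin 3, ((y b a : ℝ) : ℂ) • genE a) = 0 := by rw [← hy b, hb]; rfl
  have hT0 := logCoordCLM_genE_sum hT (WithLp.toLp 2 fun a => ((y b a : ℝ) : ℂ))
  have hsum : (∑ a : Fin 3, (WithLp.toLp 2 fun a => ((y b a : ℝ) : ℂ) : EuclideanSpace ℂ (Fin 3)) a • genE a) = ∑ a : Fin 3, ((y b a : ℝ) : ℂ) • genE a := rfl
  rw [hsum, h0, map_zero] at hT0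
  ext a
  have h := congrArg (fun v : EuclideanSpace ℂ (Fin 3) => v a) hT0
  simp at h
  have h' : (y b).ofLp a = 0 := Complex.ofReal_eq_zero.1 h.symm
  simpa using h'

/-! ## §2 The letter on the forest slice at a guarded curved base -/

section Curved

variable {F : T4Family} {K k : ℕ}

/-- ★★★ **dag-n12-w1's `hR` ∕ [15] (45) FOR THE FOREST SLICE AT A GUARDED CURVED BASE** (`SU(2)`): at `U₀` with `t₀`-small iterated averages below `k` (`stokesConst·t₀ < δ₂`) and `DΦ_{U₀}(0)` onto,
for a rooted forest with (F1), roots ⊇ `R(𝐁, k)`, and the complex slice `S` with (F3) `X ∈ S ↔ X = 0` on every path bond: for every real datum `τ` a REAL bond field `p` with `cplxVec p ∈ S` and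
`Q_{j_i}(↑U₀)[b ↦ (Σ_a p_{b,a}E_a)·U₀,b](c_i) = ↑Ū^{j_i}(U₀)(c_i)·Σ_a τ_{i,a}E_a` — the letter's shape with `W := M˙(U₀)`.
[cite: Balaban1985Variational, (3)–(4) p.278, (44)–(45) p.285; Balaban1985Averaging, (11) p.19, (17) p.21; Balaban1985RegularSpaces, (1.19) p.79] -/
theorem exists_forest_hR_of_surjective_curved (𝔹 : DetSet (F.P K)) (hk : k ≤ (F.P K).m + (F.P K).K)
    {t₀ : ℝ} (ht₀ : 0 < t₀) (hstδ : stokesConst (F.P K) * t₀ < deltaSU (Fin 2))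
    {U₀ : GaugeField (F.P K) 0 (SU 2)} (hsm : ∀ i, i < k → PlaqSmall t₀ (Averaging.iter (avOfRecord F 2 K) i U₀))
    {path : Site (F.P K) 0 → List (LStep (F.P K) 0)}
    (hroot : ∀ r ∈ {z : Site (F.P K) 0 | ∃ j, j ≤ k ∧ ∃ c ∈ bondsOf (𝔹 j), (z = embIter j c.src ∨ z = embIter j c.tgt)}, path r = [])
    (hF1 : ∀ x, ∀ s ∈ path x, ∃ x' x'' : Site (F.P K) 0, path x'' = path x' ++ [s] ∧
      (s.fwd = true → s.bond.src = x' ∧ s.bond.tgt = x'') ∧ (s.fwd = false → s.bond.src = x'' ∧ s.bond.tgt = x'))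
    {S : Submodule ℂ (VecField (F.P K) 0 (EuclideanSpace ℂ (Fin 3)))}
    (hS : ∀ X : VecField (F.P K) 0 (EuclideanSpace ℂ (Fin 3)), X ∈ S ↔ ∀ x, ∀ s ∈ path x, X s.bond = 0)
    (hsurj : Function.Surjective (fderiv ℝ (msChart F 2 K k 𝔹 (avgFamily (avOfRecord F 2 K) U₀) U₀) 0))
    (τ : Fin (constrCard 𝔹 k) → EuclideanSpace ℝ (Fin 3)) :
    ∃ p : VecField (F.P K) 0 E3, cplxVec p ∈ S ∧
      ∀ i : Fin (constrCard 𝔹 k), dIterL (((constrEnum 𝔹 k).symm i).1 : ℕ) (coeField U₀)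
          (fun b => (∑ a : Fin 3, ((p b a : ℝ) : ℂ) • genE a) * ((U₀ b : SU 2) : Matrix (Fin 2) (Fin 2) ℂ)) ((constrEnum 𝔹 k).symm i).2.1 =
        ((avgFamily (avOfRecord F 2 K) U₀ ((constrEnum 𝔹 k).symm i).1 ((constrEnum 𝔹 k).symm i).2.1 : SU 2) : Matrix (Fin 2) (Fin 2) ℂ) *
          ∑ b : Fin 3, ((τ i b : ℝ) : ℂ) • genE b := by
  obtain ⟨q, hqS, hq⟩ := exists_forest_leftField_of_surjective_curved 𝔹 hk ht₀ hstδ hsm hroot hF1 hsurj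
    (fun i => ⟨∑ b : Fin 3, ((τ i b : ℝ) : ℂ) • genE b, sum_ofReal_smul_genE_mem_lieSU _⟩)
  obtain ⟨p, hp, hp0⟩ := exists_realCoord_lieSU_two_field q
  refine ⟨p, (hS _).2 fun x s hs => ?_, fun i => ?_⟩
  · have h := hp0 _ (hqS x s hs)
    ext a
    simp [cplxVec, h]
  · rw [funext fun b => congrArg (· * ((U₀ b : SU 2) : Matrix (Fin 2) (Fin 2) ℂ)) (hp b)]
    exact hq i

/-- ★★ **THE SAME WITH THE DATUM `W` OF THE FIBRE THROUGH `U₀` ON THE RIGHT-HAND SIDE** (`AgreeOn 𝐁 (M˙U₀) W`): dag-n12-w1's `hR` verbatim. [cite: Balaban1985Variational, (44)–(45) p.285; Balaban1988Convergent, (2.10)–(2.12) p.256] -/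
theorem exists_forest_hR_of_surjective_curved_of_agreeOn (𝔹 : DetSet (F.P K)) (hk : k ≤ (F.P K).m + (F.P K).K)
    {t₀ : ℝ} (ht₀ : 0 < t₀) (hstδ : stokesConst (F.P K) * t₀ < deltaSU (Fin 2))
    {U₀ : GaugeField (F.P K) 0 (SU 2)} (hsm : ∀ i, i < k → PlaqSmall t₀ (Averaging.iter (avOfRecord F 2 K) i U₀))
    {W : MSField (F.P K) (SU 2)} (hW : AgreeOn 𝔹 (avgFamily (avOfRecord F 2 K) U₀) W)
    {path : Site (F.P K) 0 → List (LStep (F.P K) 0)}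
    (hroot : ∀ r ∈ {z : Site (F.P K) 0 | ∃ j, j ≤ k ∧ ∃ c ∈ bondsOf (𝔹 j), (z = embIter j c.src ∨ z = embIter j c.tgt)}, path r = [])
    (hF1 : ∀ x, ∀ s ∈ path x, ∃ x' x'' : Site (F.P K) 0, path x'' = path x' ++ [s] ∧
      (s.fwd = true → s.bond.src = x' ∧ s.bond.tgt = x'') ∧ (s.fwd = false → s.bond.src = x'' ∧ s.bond.tgt = x'))
    {S : Submodule ℂ (VecField (F.P K) 0 (EuclideanSpace ℂ (Fin 3)))}
    (hS : ∀ X : VecField (F.P K) 0 (EuclideanSpace ℂ (Fin 3)), X ∈ S ↔ ∀ x, ∀ s ∈ path x, X s.bond = 0)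
    (hsurj : Function.Surjective (fderiv ℝ (msChart F 2 K k 𝔹 (avgFamily (avOfRecord F 2 K) U₀) U₀) 0))
    (τ : Fin (constrCard 𝔹 k) → EuclideanSpace ℝ (Fin 3)) :
    ∃ p : VecField (F.P K) 0 E3, cplxVec p ∈ S ∧
      ∀ i : Fin (constrCard 𝔹 k), dIterL (((constrEnum 𝔹 k).symm i).1 : ℕ) (coeField U₀)
          (fun b => (∑ a : Fin 3, ((p b a : ℝ) : ℂ) • genE a) * ((U₀ b : SU 2) : Matrix (Fin 2) (Fin 2) ℂ)) ((constrEnum 𝔹 k).symm i).2.1 =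
        ((W ((constrEnum 𝔹 k).symm i).1 ((constrEnum 𝔹 k).symm i).2.1 : SU 2) : Matrix (Fin 2) (Fin 2) ℂ) * ∑ b : Fin 3, ((τ i b : ℝ) : ℂ) • genE b := by
  obtain ⟨p, hpS, hp⟩ := exists_forest_hR_of_surjective_curved 𝔹 hk ht₀ hstδ hsm hroot hF1 hS hsurj τ
  refine ⟨p, hpS, fun i => ?_⟩
  rw [hp i, hW _ _ ((constrEnum 𝔹 k).symm i).2.2]

end Curved

/-! ## §3 At the record's `𝐁_k(Z)` -/

section Record

open Literature.MathematicalPhysics.QuantumFieldTheory.Balaban1983to89.B14.Eq213DetSet (Bj)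
open Literature.MathematicalPhysics.QuantumFieldTheory.Balaban1983to89.B14.Eq213MaximalDomains (side)

variable {F : T4Family} {K k M₁ : ℕ} {Z : Set (Site (F.P K) 0)}

/-- ★★★ **THE LETTER ON THE FOREST SLICE AT THE FLAT BASE OF RECORD, HYPOTHESIS-FREE**: for `𝐁_k(Z)` (`2 ≤ M₁`, `1 ≤ k ≤ m + K`, cover divisibility) a rooted forest `path` ((F1), (F2), (TREE)) and
its conjugation-stable complex slice `S` ((F3)) such that at `U₀ = 1` dag-n12-w1's `hR` holds for `S`: every real datum `τ` is reached by a REAL field `p` with `cplxVec p ∈ S`.  (`Ū^j(1) = 1`: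
the right-hand side is `Σ_a τ_{i,a}E_a`; surjectivity by dag-n10-w1's `surjective_fderiv_msChart_Bj_one`.) [cite: Balaban1985Variational, (44)–(45) p.285, (4) p.278; Balaban1988Convergent, (2.13) pp.256–257] -/
theorem exists_forest_hR_Bj_one_atRecord (hk : k ≤ (F.P K).m + (F.P K).K) (hk1 : 1 ≤ k) (hM2 : 2 ≤ M₁) (hdiv : side (F.P K).L M₁ k ∣ (F.P K).sitesPerDir 0) :
    ∃ (path : Site (F.P K) 0 → List (LStep (F.P K) 0)) (S : Submodule ℂ (VecField (F.P K) 0 (EuclideanSpace ℂ (Fin 3)))),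
      (∀ x, ∀ s ∈ path x, ∃ x' x'' : Site (F.P K) 0, path x'' = path x' ++ [s] ∧
        (s.fwd = true → s.bond.src = x' ∧ s.bond.tgt = x'') ∧ (s.fwd = false → s.bond.src = x'' ∧ s.bond.tgt = x')) ∧
      (∀ j, j ≤ k → ∀ c ∈ bondsOf ((Bj M₁ Z k : DetSet (F.P K)) j), path (embIter j c.src) = [] ∧ path (embIter j c.tgt) = []) ∧
      (∀ x : Site (F.P K) 0, x ∉ {z : Site (F.P K) 0 | ∃ j, j ≤ k ∧ ∃ c ∈ bondsOf ((Bj M₁ Z k : DetSet (F.P K)) j), (z = embIter j c.src ∨ z = embIter j c.tgt)} →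
        ∃ (x' : Site (F.P K) 0) (s : LStep (F.P K) 0), path x = path x' ++ [s] ∧
          (s.fwd = true → s.bond.src = x' ∧ s.bond.tgt = x) ∧ (s.fwd = false → s.bond.src = x ∧ s.bond.tgt = x')) ∧
      (∀ X, X ∈ S ↔ ∀ x, ∀ s ∈ path x, X s.bond = 0) ∧ (∀ X ∈ S, conjVec X ∈ S) ∧
      ∀ τ : Fin (constrCard (Bj M₁ Z k : DetSet (F.P K)) k) → EuclideanSpace ℝ (Fin 3), ∃ p : VecField (F.P K) 0 E3, cplxVec p ∈ S ∧
        ∀ i, dIterL (((constrEnum (Bj M₁ Z k : DetSet (F.P K)) k).symm i).1 : ℕ) (coeField (1 : GaugeField (F.P K) 0 (SU 2)))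
            (fun b => (∑ a : Fin 3, ((p b a : ℝ) : ℂ) • genE a) * (((1 : GaugeField (F.P K) 0 (SU 2)) b : SU 2) : Matrix (Fin 2) (Fin 2) ℂ))
            ((constrEnum (Bj M₁ Z k : DetSet (F.P K)) k).symm i).2.1 =
          ((avgFamily (avOfRecord F 2 K) (1 : GaugeField (F.P K) 0 (SU 2)) ((constrEnum (Bj M₁ Z k : DetSet (F.P K)) k).symm i).1
              ((constrEnum (Bj M₁ Z k : DetSet (F.P K)) k).symm i).2.1 : SU 2) : Matrix (Fin 2) (Fin 2) ℂ) * ∑ b : Fin 3, ((τ i b : ℝ) : ℂ) • genE b := by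
  obtain ⟨path, hF1, hF2, htree⟩ := exists_rootedForest_Bj (P := F.P K) (Z := Z) hk hk1 (le_trans (by norm_num) hM2) hdiv
  obtain ⟨S, hS, hconj⟩ := exists_forestSlice path
  have hroot : ∀ r ∈ {z : Site (F.P K) 0 | ∃ j, j ≤ k ∧ ∃ c ∈ bondsOf ((Bj M₁ Z k : DetSet (F.P K)) j), (z = embIter j c.src ∨ z = embIter j c.tgt)}, path r = [] := by
    rintro r ⟨j, hj, c, hc, rfl | rfl⟩
    · exact (hF2 j hj c hc).1
    · exact (hF2 j hj c hc).2
  obtain ⟨t₀, ht₀, hst⟩ := exists_stokesThreshold (P := F.P K) (N := 2)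
  exact ⟨path, S, hF1, hF2, htree, hS, hconj, fun τ => exists_forest_hR_of_surjective_curved (Bj M₁ Z k) hk ht₀ hst (fun i _ => plaqSmall_iter_one ht₀ i) hroot hF1 hS
    (surjective_fderiv_msChart_Bj_one (F := F) (N := 2) (K := K) (k := k) hM2 hk (Z := Z) hdiv) τ⟩

/-- ★★★ **THE LETTER ON THE FOREST SLICE AT EVERY GUARDED NEAR-FLAT BASE OF RECORD**: one rooted forest, its conjugation-stable complex slice, one radius `ρ′ > 0`; at every `U₀` with `t₀`-small
iterated averages below `k` (`stokesConst·t₀ < δ₂`) and `‖↑U₀ − 1‖ < ρ′`, dag-n12-w1's `hR` holds for `S` with `W := M˙(U₀)` (surjectivity by dag-n10-w1's `surjective_fderiv_msChart_Bj`; rewrite to the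
fibre's datum by `AgreeOn` as in §2). [cite: Balaban1985Variational, (44)–(46) p.285, (4) p.278; Balaban1985Averaging, Prop. 3 p.36, (11) p.19; Balaban1988Convergent, (2.13) pp.256–257] -/
theorem exists_forest_hR_Bj_nearFlat_atRecord (hk : k ≤ (F.P K).m + (F.P K).K) (hk1 : 1 ≤ k) (hM2 : 2 ≤ M₁) (hdiv : side (F.P K).L M₁ k ∣ (F.P K).sitesPerDir 0) :
    ∃ (path : Site (F.P K) 0 → List (LStep (F.P K) 0)) (S : Submodule ℂ (VecField (F.P K) 0 (EuclideanSpace ℂ (Fin 3)))) (ρ' : ℝ), 0 < ρ' ∧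
      (∀ x, ∀ s ∈ path x, ∃ x' x'' : Site (F.P K) 0, path x'' = path x' ++ [s] ∧
        (s.fwd = true → s.bond.src = x' ∧ s.bond.tgt = x'') ∧ (s.fwd = false → s.bond.src = x'' ∧ s.bond.tgt = x')) ∧
      (∀ j, j ≤ k → ∀ c ∈ bondsOf ((Bj M₁ Z k : DetSet (F.P K)) j), path (embIter j c.src) = [] ∧ path (embIter j c.tgt) = []) ∧
      (∀ x : Site (F.P K) 0, x ∉ {z : Site (F.P K) 0 | ∃ j, j ≤ k ∧ ∃ c ∈ bondsOf ((Bj M₁ Z k : DetSet (F.P K)) j), (z = embIter j c.src ∨ z = embIter j c.tgt)} →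
        ∃ (x' : Site (F.P K) 0) (s : LStep (F.P K) 0), path x = path x' ++ [s] ∧
          (s.fwd = true → s.bond.src = x' ∧ s.bond.tgt = x) ∧ (s.fwd = false → s.bond.src = x ∧ s.bond.tgt = x')) ∧
      (∀ X, X ∈ S ↔ ∀ x, ∀ s ∈ path x, X s.bond = 0) ∧ (∀ X ∈ S, conjVec X ∈ S) ∧
      ∀ ⦃t₀ : ℝ⦄, 0 < t₀ → stokesConst (F.P K) * t₀ < deltaSU (Fin 2) →
        ∀ U₀ : GaugeField (F.P K) 0 (SU 2), (∀ i, i < k → PlaqSmall t₀ (Averaging.iter (avOfRecord F 2 K) i U₀)) → ‖coeField U₀ - 1‖ < ρ' →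
          ∀ τ : Fin (constrCard (Bj M₁ Z k : DetSet (F.P K)) k) → EuclideanSpace ℝ (Fin 3), ∃ p : VecField (F.P K) 0 E3, cplxVec p ∈ S ∧
            ∀ i, dIterL (((constrEnum (Bj M₁ Z k : DetSet (F.P K)) k).symm i).1 : ℕ) (coeField U₀)
                (fun b => (∑ a : Fin 3, ((p b a : ℝ) : ℂ) • genE a) * ((U₀ b : SU 2) : Matrix (Fin 2) (Fin 2) ℂ)) ((constrEnum (Bj M₁ Z k : DetSet (F.P K)) k).symm i).2.1 =
              ((avgFamily (avOfRecord F 2 K) U₀ ((constrEnum (Bj M₁ Z k : DetSet (F.P K)) k).symm i).1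
                  ((constrEnum (Bj M₁ Z k : DetSet (F.P K)) k).symm i).2.1 : SU 2) : Matrix (Fin 2) (Fin 2) ℂ) * ∑ b : Fin 3, ((τ i b : ℝ) : ℂ) • genE b := by
  obtain ⟨path, hF1, hF2, htree⟩ := exists_rootedForest_Bj (P := F.P K) (Z := Z) hk hk1 (le_trans (by norm_num) hM2) hdiv
  obtain ⟨S, hS, hconj⟩ := exists_forestSlice path
  have hroot : ∀ r ∈ {z : Site (F.P K) 0 | ∃ j, j ≤ k ∧ ∃ c ∈ bondsOf ((Bj M₁ Z k : DetSet (F.P K)) j), (z = embIter j c.src ∨ z = embIter j c.tgt)}, path r = [] := by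
    rintro r ⟨j, hj, c, hc, rfl | rfl⟩
    · exact (hF2 j hj c hc).1
    · exact (hF2 j hj c hc).2
  obtain ⟨ρ', hρ', hsurj⟩ := surjective_fderiv_msChart_Bj (F := F) (N := 2) (K := K) (k := k) hM2 hk (Z := Z) hdiv
  exact ⟨path, S, ρ', hρ', hF1, hF2, htree, hS, hconj, fun t₀ ht₀ hstδ U₀ hsm hU τ =>
    exists_forest_hR_of_surjective_curved (Bj M₁ Z k) hk ht₀ hstδ hsm hroot hF1 hS (hsurj ht₀ hstδ U₀ hsm hU) τ⟩

end Record

end Summit.QuantumFields.YangMills.BalabanUVNodes.N12ForestSliceHR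

end
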